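import Literature.Probability.Percolation.LocalEvents
import Literature.Probability.Percolation.InsertionTolerance
import HarnessLib

/-!
# Local events: comparison of measures, and pull-backs under opening edges

Topic `Literature/Probability/Percolation`, namespace `Literature.StatMech`. Two general complements to
`LocalEvents.lean` (local events form a ring generating the product σ-algebra; measurable events
are approximated by local events) and `InsertionTolerance.lean` (`openEdges F ω = ω ∪ F`):

* `measure_le_of_forall_isLocalEvent_le` — if two finite measures on configurations satisfy
  `ν A ≤ μ A` for every local event `A`, then `ν S ≤ μ S` for every measurable `S`
  (approximate `S` by a local event in `(μ + ν)`-measure). This is the reduction "it is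
  sufficient to consider events `ℰ` depending on a finite number of edges" in the proof of the
  insertion tolerance of the infinite-volume random currents, Aizenman–Duminil-Copin–Sidoravicius,
  CMP **334** (2015), Lemma 2.6, where the finite-volume inequality `c ℙ[Φ̂_N⁻¹ℰ] ≤ ℙ[ℰ]` is
  first passed to the weak limit on local events.
* `DeterminedBy.preimage_openEdges`, `IsLocalEvent.preimage_openEdges` — the pull-back of an
  event determined by `F` under "open the edges of `E`" is determined by `F` (reading `ω ∪ E` on
  `F` only requires `ω` on `F`); compare `determinedBy_preimage_openEdges`
  (`InsertionTolerance.lean`: determined by the edges off `E`).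

## Mathlib status

Anchors: `ENNReal.le_of_forall_pos_le_add`, `ENNReal.add_halves`, `MeasureTheory.measure_union_le`;
tree: `exists_isLocalEvent_measure_symmDiff_lt` (`LocalEvents.lean`), `openEdges`
(`InsertionTolerance.lean`).
-/

noncomputable section

namespace Literature.Probability.Percolation

open MeasureTheory
open scoped symmDiff ENNReal

/-- **Comparison of finite measures on local events extends to all events**: if `ν A ≤ μ A` for
every local event `A`, then `ν S ≤ μ S` for every measurable `S` (approximate `S` by a local
event `B` with `(μ + ν)(B ∆ S) < ε`, `exists_isLocalEvent_measure_symmDiff_lt`). This is the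
reduction "it is sufficient to consider events depending on a finite number of edges" of the
ADS15 proof of Lemma 2.6. [cite: AizenmanDuminilCopinSidoraviciusCMP2015, Lemma 2.6, proof] -/
theorem measure_le_of_forall_isLocalEvent_le {ι : Type*} {μ ν : Measure (Set ι)} [IsFiniteMeasure μ]
    [IsFiniteMeasure ν] (h : ∀ A : Set (Set ι), IsLocalEvent A → ν A ≤ μ A)
    {S : Set (Set ι)} (hS : MeasurableSet S) : ν S ≤ μ S := by
  refine ENNReal.le_of_forall_pos_le_add fun ε hε _ => ?_
  have hε2 : (0 : ℝ≥0∞) < (ε : ℝ≥0∞) / 2 :=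
    ENNReal.half_pos (by exact_mod_cast hε.ne')
  obtain ⟨B, hB, hBS⟩ := exists_isLocalEvent_measure_symmDiff_lt (μ := μ + ν) hS hε2
  have hSB : S \ B ⊆ B ∆ S := fun ω hω => Or.inr hω
  have hBS' : B \ S ⊆ B ∆ S := fun ω hω => Or.inl hω
  have hν : ν (B ∆ S) ≤ (μ + ν) (B ∆ S) := by
    rw [Measure.add_apply]; exact le_add_self
  have hμ : μ (B ∆ S) ≤ (μ + ν) (B ∆ S) := by
    rw [Measure.add_apply]; exact le_self_add
  have hS1 : S ⊆ B ∪ (S \ B) := fun ω hω => by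
    by_cases hB : ω ∈ B
    · exact Or.inl hB
    · exact Or.inr ⟨hω, hB⟩
  have hB1 : B ⊆ S ∪ (B \ S) := fun ω hω => by
    by_cases hS : ω ∈ S
    · exact Or.inl hS
    · exact Or.inr ⟨hω, hS⟩
  have hBle : μ B ≤ μ S + (μ + ν) (B ∆ S) :=
    calc μ B ≤ μ (S ∪ (B \ S)) := measure_mono hB1
      _ ≤ μ S + μ (B \ S) := measure_union_le _ _
      _ ≤ μ S + (μ + ν) (B ∆ S) := add_le_add le_rfl ((measure_mono hBS').trans hμ)
  calc ν S ≤ ν (B ∪ (S \ B)) := measure_mono hS1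
    _ ≤ ν B + ν (S \ B) := measure_union_le _ _
    _ ≤ μ B + (μ + ν) (B ∆ S) := add_le_add (h B hB) ((measure_mono hSB).trans hν)
    _ ≤ (μ S + (μ + ν) (B ∆ S)) + (μ + ν) (B ∆ S) := add_le_add hBle le_rfl
    _ ≤ (μ S + (ε : ℝ≥0∞) / 2) + (ε : ℝ≥0∞) / 2 :=
        add_le_add (add_le_add le_rfl hBS.le) hBS.le
    _ = μ S + ε := by rw [add_assoc, ENNReal.add_halves]

/-- The pull-back of an event determined by `F` under "open the edges of `E`" is determined by
`F` (reading `ω ∪ E` on `F` only requires `ω` on `F`). [folklore] -/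
theorem DeterminedBy.preimage_openEdges {ι : Type*} {A : Set (Set (Sym2 ι))} {F : Set (Sym2 ι)}
    (hA : DeterminedBy A F) (E : Set (Sym2 ι)) : DeterminedBy (openEdges E ⁻¹' A) F := by
  rw [determinedBy_iff] at hA ⊢
  intro ω ω' h
  simp only [Set.mem_preimage]
  refine hA _ _ ?_
  rw [openEdges, openEdges, Set.union_inter_distrib_right, Set.union_inter_distrib_right, h]

/-- The pull-back of a local event under "open the edges of `E`" is local. [folklore] -/
theorem IsLocalEvent.preimage_openEdges {ι : Type*} {A : Set (Set (Sym2 ι))} (hA : IsLocalEvent A)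
    (E : Set (Sym2 ι)) : IsLocalEvent (openEdges E ⁻¹' A) := by
  obtain ⟨F, hF⟩ := hA
  exact ⟨F, hF.preimage_openEdges E⟩

end Literature.Probability.Percolation
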